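import Mathlib.RingTheory.ZMod.UnitsCyclic
import Mathlib.NumberTheory.ArithmeticFunction.VonMangoldt
import Mathlib.NumberTheory.Harmonic.Bounds
import Mathlib.Analysis.SpecialFunctions.Pow.Asymptotics
import Mathlib.Analysis.Complex.ExponentialBounds
import Mathlib.Data.Nat.Factorization.Induction
import Mathlib.Data.Nat.Squarefree
import HarnessLib

/-!
# Prime powers in arithmetic progressions, on average over the modulus

Topic `Literature/NumberTheory/Sieve`.  Elementary counting lemmas (all folklore) feeding the
equivalence of the `ψ`- and `π`-forms of "the primes have level of distribution `x^θ`"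
(`Literature.NumberTheory.Sieve.primesHaveLevel_iff_primesHaveLevelPi`, `LevelOfDistribution.lean`) in the
Elliott–Halberstam range `1/2 < θ ≤ 1`, where the contribution of the prime powers `p^k`, `k ≥ 2`,
to `ψ(x; q, a)` must be bounded on average over `q ≤ x^{1−ε}` uniformly in the reduced residue `a`.

## Contents

* `k`-th roots in finite commutative groups: `#{u : u^k = a} ≤ #{u : u^k = 1}`, and `≤ k` in a
  cyclic group (Mathlib `IsCyclic.card_pow_eq_one_le`); multiplicativity over `G ≃* H × K`.
* `natCard_units_zmod_pow_eq_le`: for `q ≥ 1`, `k ≥ 1` and a unit `a` mod `q`,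
  `#{u ∈ (ℤ/qℤ)ˣ : u^k = a} ≤ k^{ω(q)} · 2^{v₂(q)}` (Chinese remainder theorem, Mathlib
  `ZMod.chineseRemainder`, and cyclicity of `(ℤ/p^nℤ)ˣ` for odd `p`, Mathlib
  `ZMod.isCyclic_units_of_prime_pow`; the factor `2^{v₂(q)}` is the trivial bound at `p = 2`).
* Integers `n ≤ X` in a set `T` of residues mod `q`: at most `#T · (X/q + 1)`.
* `∑_{q ≤ Q} k^{ω(q)}/q ≤ H_Q^k` (`H_Q` the harmonic number), via `(k+1)^{ω(m)} ≤ ∑_{d ∣ m} k^{ω(d)}`.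
* The number of prime powers `p^k ≤ N`, `k ≥ 2`, in a reduced class `a (mod q)`, pointwise and
  summed over `q ≤ Q`.

## References

Folklore; the use (prime powers are negligible in Bombieri–Vinogradov type averages) is
Iwaniec–Kowalski, *Analytic Number Theory*, §17.1, and Cojocaru–Murty, *An Introduction to Sieve
Methods and their Applications*, proof of Thm 9.2.1.
-/

open Finset Filter Asymptotics
open scoped ArithmeticFunction.vonMangoldt

namespace Literature.NumberTheory.Sieve

/-! ### `k`-th roots in a finite commutative group -/

section Group

variable {G : Type*} [CommGroup G]

/-- In a finite commutative group the equation `u^k = a` has at most as many solutions as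
`u^k = 1` (a nonempty solution set is a coset of the `k`-torsion). [folklore] -/
theorem natCard_pow_eq_le_natCard_pow_eq_one [Finite G] (k : ℕ) (a : G) :
    Nat.card {u : G // u ^ k = a} ≤ Nat.card {u : G // u ^ k = 1} := by
  classical
  by_cases h : ∃ u₀ : G, u₀ ^ k = a
  · obtain ⟨u₀, hu₀⟩ := h
    refine Nat.card_le_card_of_injective (fun u => ⟨u.1 * u₀⁻¹, ?_⟩) ?_
    · rw [mul_pow, inv_pow, u.2, hu₀, mul_inv_cancel]
    · intro u v huv
      exact Subtype.ext (mul_right_cancel (Subtype.ext_iff.mp huv))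
  · push Not at h
    haveI : IsEmpty {u : G // u ^ k = a} := ⟨fun u => h u.1 u.2⟩
    simp

/-- In a finite cyclic group the equation `u^k = a` (`k ≥ 1`) has at most `k` solutions
(Mathlib: `IsCyclic.card_pow_eq_one_le`). [folklore] -/
theorem natCard_pow_eq_le_of_isCyclic [Finite G] [IsCyclic G] {k : ℕ} (hk : 0 < k) (a : G) :
    Nat.card {u : G // u ^ k = a} ≤ k := by
  classical
  haveI := Fintype.ofFinite G
  refine (natCard_pow_eq_le_natCard_pow_eq_one k a).trans ?_
  rw [Nat.card_eq_fintype_card, Fintype.card_subtype]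
  convert IsCyclic.card_pow_eq_one_le (α := G) hk

/-- The number of solutions of `u^k = a` is multiplicative over a product decomposition
`G ≃* H × K`. [folklore] -/
theorem natCard_pow_eq_of_mulEquiv_prod {H K : Type*} [CommGroup H] [CommGroup K]
    (e : G ≃* H × K) (k : ℕ) (a : G) :
    Nat.card {u : G // u ^ k = a} =
      Nat.card {v : H // v ^ k = (e a).1} * Nat.card {w : K // w ^ k = (e a).2} := by
  rw [← Nat.card_prod]
  refine Nat.card_congr ((Equiv.subtypeEquiv e.toEquiv (fun u => ?_)).trans
    (Equiv.subtypeProdEquivProd (p := fun v : H => v ^ k = (e a).1)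
      (q := fun w : K => w ^ k = (e a).2)))
  change u ^ k = a ↔ (e u).1 ^ k = (e a).1 ∧ (e u).2 ^ k = (e a).2
  rw [← e.injective.eq_iff, map_pow, Prod.ext_iff, Prod.pow_fst, Prod.pow_snd]

end Group

/-! ### `k`-th roots of a unit modulo `q` -/

/-- **The number of `k`-th roots of a unit modulo `q`.**  For `q ≥ 1`, `k ≥ 1` and `a ∈ (ℤ/qℤ)ˣ`,
`#{u ∈ (ℤ/qℤ)ˣ : u^k = a} ≤ k^{ω(q)} · 2^{v₂(q)}`: by the Chinese remainder theorem the count is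
multiplicative in `q`; for an odd prime power `p^n` the unit group is cyclic, so the count is
`≤ k`; for `2^n` we use the trivial bound `φ(2^n) ≤ 2^n`. [folklore] -/
theorem natCard_units_zmod_pow_eq_le {k : ℕ} (hk : 0 < k) :
    ∀ q : ℕ, 0 < q → ∀ a : (ZMod q)ˣ,
      Nat.card {u : (ZMod q)ˣ // u ^ k = a} ≤ k ^ q.primeFactors.card * 2 ^ q.factorization 2 := by
  intro q
  induction q using Nat.recOnPosPrimePosCoprime with
  | zero => intro h; exact absurd h (lt_irrefl 0)
  | one =>
    intro _ a
    rw [Nat.primeFactors_one, Finset.card_empty, pow_zero, Nat.factorization_one,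
      Finsupp.zero_apply, pow_zero, one_mul]
    calc Nat.card {u : (ZMod 1)ˣ // u ^ k = a} ≤ Nat.card (ZMod 1)ˣ := Finite.card_subtype_le _
      _ = 1 := by rw [Nat.card_eq_fintype_card, ZMod.card_units_eq_totient, Nat.totient_one]
  | prime_pow p n hp hn =>
    intro _ a
    haveI : NeZero (p ^ n) := ⟨pow_ne_zero n hp.ne_zero⟩
    haveI : Fact p.Prime := ⟨hp⟩
    rw [Nat.primeFactors_prime_pow hn.ne' hp, Finset.card_singleton, pow_one,
      hp.factorization_pow]
    by_cases hp2 : p = 2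
    · subst hp2
      rw [Finsupp.single_eq_same]
      calc Nat.card {u : (ZMod (2 ^ n))ˣ // u ^ k = a} ≤ Nat.card (ZMod (2 ^ n))ˣ :=
            Finite.card_subtype_le _
        _ = Nat.totient (2 ^ n) := by rw [Nat.card_eq_fintype_card, ZMod.card_units_eq_totient]
        _ ≤ 2 ^ n := Nat.totient_le _
        _ ≤ k * 2 ^ n := Nat.le_mul_of_pos_left _ hk
    · rw [Finsupp.single_eq_of_ne' hp2, pow_zero, mul_one]
      haveI := ZMod.isCyclic_units_of_prime_pow p hp hp2 n
      exact natCard_pow_eq_le_of_isCyclic hk a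
  | coprime a b ha hb hab iha ihb =>
    intro _ x
    have ha0 : a ≠ 0 := by omega
    have hb0 : b ≠ 0 := by omega
    let e : (ZMod (a * b))ˣ ≃* (ZMod a)ˣ × (ZMod b)ˣ :=
      (Units.mapEquiv (ZMod.chineseRemainder hab).toMulEquiv).trans MulEquiv.prodUnits
    rw [natCard_pow_eq_of_mulEquiv_prod e k x, hab.primeFactors_mul,
      Finset.card_union_of_disjoint hab.disjoint_primeFactors, Nat.factorization_mul ha0 hb0,
      Finsupp.add_apply, pow_add, pow_add, mul_mul_mul_comm]
    exact Nat.mul_le_mul (iha (by omega) _) (ihb (by omega) _)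

/-! ### Integers `≤ X` in a set of residue classes -/

/-- For `q ≥ 1` and a residue `t mod q`, `#{n ≤ X : n ≡ t (mod q)} ≤ X/q + 1` (the map
`n ↦ ⌊n/q⌋` is injective on a residue class). [folklore] -/
theorem card_range_filter_natCast_eq_le (q : ℕ) (t : ZMod q) (X : ℕ) :
    #((range (X + 1)).filter fun n : ℕ => (n : ZMod q) = t) ≤ X / q + 1 := by
  calc #((range (X + 1)).filter fun n : ℕ => (n : ZMod q) = t) ≤ #(range (X / q + 1)) := by
        refine card_le_card_of_injOn (fun n : ℕ => n / q) ?_ ?_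
        · intro n hn
          have hn' := (mem_filter.mp hn).1
          rw [mem_range] at hn'
          simp only [coe_range, Set.mem_Iio]
          exact Nat.lt_succ_of_le (Nat.div_le_div_right (Nat.le_of_lt_succ hn'))
        · intro n hn m hm hnm
          have h1 : n % q = m % q :=
            (ZMod.natCast_eq_natCast_iff' n m q).mp
              ((mem_filter.mp hn).2.trans (mem_filter.mp hm).2.symm)
          have h2 : n / q = m / q := hnm
          rw [← Nat.div_add_mod n q, ← Nat.div_add_mod m q, h1, h2]
    _ = X / q + 1 := card_range _

/-- For a set `T` of residues mod `q`, `#{n ≤ X : n mod q ∈ T} ≤ #T · (X/q + 1)`. [folklore] -/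
theorem card_range_filter_natCast_mem_le (q : ℕ) (T : Finset (ZMod q)) (X : ℕ) :
    #((range (X + 1)).filter fun n : ℕ => (n : ZMod q) ∈ T) ≤ #T * (X / q + 1) := by
  rw [mul_comm]
  refine card_le_mul_card_image_of_maps_to (f := fun n : ℕ => (n : ZMod q))
    (fun n hn => (mem_filter.mp hn).2) _ fun t _ => ?_
  calc #(((range (X + 1)).filter fun n : ℕ => (n : ZMod q) ∈ T).filter
        fun n : ℕ => (n : ZMod q) = t)
      ≤ #((range (X + 1)).filter fun n : ℕ => (n : ZMod q) = t) := by
        refine card_le_card fun n hn => ?_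
        simp only [mem_filter] at hn ⊢
        exact ⟨hn.1.1, hn.2⟩
    _ ≤ X / q + 1 := card_range_filter_natCast_eq_le q t X

/-- **`k`-th power residues in an interval.**  For `q ≥ 1`, `k ≥ 1`, a unit `a` mod `q` and
`X ≥ 0`: `#{n ≤ X : n^k ≡ a (mod q)} ≤ k^{ω(q)} 2^{v₂(q)} (X/q + 1)` (an `n` with `n^k ≡ a` is a
unit mod `q`, and its class is one of the `≤ k^{ω(q)} 2^{v₂(q)}` `k`-th roots of `a`). [folklore] -/
theorem card_range_filter_pow_eq_le {k : ℕ} (hk : 0 < k) {q : ℕ} (hq : 0 < q) (a : (ZMod q)ˣ)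
    (X : ℕ) :
    #((range (X + 1)).filter fun n : ℕ => (n : ZMod q) ^ k = a) ≤
      k ^ q.primeFactors.card * 2 ^ q.factorization 2 * (X / q + 1) := by
  classical
  haveI : NeZero q := ⟨hq.ne'⟩
  set T : Finset (ZMod q) :=
    ((univ : Finset (ZMod q)ˣ).filter fun u => u ^ k = a).image (Units.val : (ZMod q)ˣ → ZMod q)
    with hT
  have hTcard : #T ≤ k ^ q.primeFactors.card * 2 ^ q.factorization 2 := by
    refine card_image_le.trans ?_
    have h := natCard_units_zmod_pow_eq_le hk q hq a
    rw [Nat.card_eq_fintype_card, Fintype.card_subtype] at h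
    convert h
  have hsub : ((range (X + 1)).filter fun n : ℕ => (n : ZMod q) ^ k = a) ⊆
      ((range (X + 1)).filter fun n : ℕ => (n : ZMod q) ∈ T) := by
    intro n hn
    simp only [mem_filter] at hn ⊢
    refine ⟨hn.1, ?_⟩
    have hu : IsUnit ((n : ZMod q)) := (isUnit_pow_iff hk.ne').mp (hn.2 ▸ Units.isUnit a)
    refine mem_image.mpr ⟨hu.unit, mem_filter.mpr ⟨mem_univ _, Units.ext ?_⟩, hu.unit_spec⟩
    rw [Units.val_pow_eq_pow_val, hu.unit_spec, hn.2]
  exact (card_le_card hsub).trans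
    ((card_range_filter_natCast_mem_le q T X).trans (Nat.mul_le_mul_right _ hTcard))

/-! ### Harmonic-type sums of `k^{ω(q)}` -/

/-- `∑_{q ≤ Q} (∑_{d ∣ q} g(d))/q ≤ (∑_{d ≤ Q} g(d)/d) · ∑_{m ≤ Q} 1/m` for `g ≥ 0`
(write `q = d m`). [folklore] -/
theorem sum_sum_divisors_div_le (g : ℕ → ℝ) (hg : ∀ d, 0 ≤ g d) (Q : ℕ) :
    ∑ q ∈ Icc 1 Q, (∑ d ∈ q.divisors, g d) / q ≤
      (∑ d ∈ Icc 1 Q, g d / d) * ∑ m ∈ Icc 1 Q, (1 : ℝ) / m := by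
  have h2 : ∑ q ∈ Icc 1 Q, (∑ d ∈ q.divisors, g d) / q =
      ∑ d ∈ Icc 1 Q, ∑ q ∈ (Icc 1 Q).filter (d ∣ ·), g d / q := by
    simp_rw [sum_div]
    refine sum_comm' fun q d => ?_
    simp only [mem_Icc, Nat.mem_divisors, mem_filter]
    constructor
    · rintro ⟨⟨hq1, hqQ⟩, hdq, hq0⟩
      exact ⟨⟨⟨hq1, hqQ⟩, hdq⟩, Nat.pos_of_dvd_of_pos hdq hq1, (Nat.le_of_dvd hq1 hdq).trans hqQ⟩
    · rintro ⟨⟨⟨hq1, hqQ⟩, hdq⟩, hd1, hdQ⟩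
      exact ⟨⟨hq1, hqQ⟩, hdq, by omega⟩
  rw [h2, sum_mul]
  refine sum_le_sum fun d hd => ?_
  have hd1 : 1 ≤ d := (mem_Icc.mp hd).1
  have hd0 : (d : ℝ) ≠ 0 := by positivity
  have hsub : (Icc 1 Q).filter (d ∣ ·) ⊆ (Icc 1 Q).image (d * ·) := by
    intro q hq
    simp only [mem_filter, mem_Icc] at hq
    obtain ⟨⟨hq1, hqQ⟩, m, rfl⟩ := hq
    refine mem_image.mpr ⟨m, mem_Icc.mpr ⟨?_, ?_⟩, rfl⟩
    · rcases Nat.eq_zero_or_pos m with rfl | hm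
      · simp at hq1
      · exact hm
    · exact le_trans (Nat.le_mul_of_pos_left m hd1) hqQ
  calc ∑ q ∈ (Icc 1 Q).filter (d ∣ ·), g d / q
      ≤ ∑ q ∈ (Icc 1 Q).image (d * ·), g d / q :=
        sum_le_sum_of_subset_of_nonneg hsub fun q _ _ => div_nonneg (hg d) (Nat.cast_nonneg _)
    _ = ∑ m ∈ Icc 1 Q, g d / d * ((1 : ℝ) / m) := by
        rw [sum_image]
        · refine sum_congr rfl fun m _ => ?_
          rw [Nat.cast_mul]
          field_simp
        · intro m _ m' _ h
          exact (Nat.mul_right_inj (by omega)).mp h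
    _ = g d / d * ∑ m ∈ Icc 1 Q, (1 : ℝ) / m := by rw [mul_sum]

/-- `(k+1)^{ω(m)} ≤ ∑_{d ∣ m} k^{ω(d)}` for `m ≠ 0`: expand `(k+1)^{ω(m)}` over the subsets `t` of the
prime factors of `m` and send `t` to the squarefree divisor `∏_{p ∈ t} p`. [folklore] -/
theorem succ_pow_card_primeFactors_le_sum_divisors (k : ℕ) {m : ℕ} (hm : m ≠ 0) :
    ((k : ℝ) + 1) ^ m.primeFactors.card ≤ ∑ d ∈ m.divisors, (k : ℝ) ^ d.primeFactors.card := by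
  have h1 : ((k : ℝ) + 1) ^ m.primeFactors.card =
      ∑ t ∈ m.primeFactors.powerset, (k : ℝ) ^ t.card := by
    rw [← Finset.sum_pow_mul_eq_add_pow (k : ℝ) 1 m.primeFactors]
    simp
  have hprime : ∀ t ∈ m.primeFactors.powerset, ∀ p ∈ t, p.Prime := fun t ht p hp =>
    Nat.prime_of_mem_primeFactors (mem_powerset.mp ht hp)
  have hinj : Set.InjOn (fun t : Finset ℕ => ∏ p ∈ t, p)
      (m.primeFactors.powerset : Set (Finset ℕ)) := by
    intro t ht t' ht' h
    have e1 := Nat.primeFactors_prod (hprime t ht)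
    have e2 := Nat.primeFactors_prod (hprime t' ht')
    rw [← e1, ← e2]
    exact congr_arg Nat.primeFactors h
  have hsub : (m.primeFactors.powerset).image (fun t : Finset ℕ => ∏ p ∈ t, p) ⊆ m.divisors := by
    intro d hd
    obtain ⟨t, ht, rfl⟩ := mem_image.mp hd
    exact Nat.mem_divisors.mpr ⟨(Finset.prod_dvd_prod_of_subset _ _ _ (mem_powerset.mp ht)).trans
      (Nat.prod_primeFactors_dvd m), hm⟩
  calc ((k : ℝ) + 1) ^ m.primeFactors.card
      = ∑ t ∈ m.primeFactors.powerset, (k : ℝ) ^ (∏ p ∈ t, p).primeFactors.card := by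
        rw [h1]
        exact sum_congr rfl fun t ht => by rw [Nat.primeFactors_prod (hprime t ht)]
    _ = ∑ d ∈ (m.primeFactors.powerset).image (fun t : Finset ℕ => ∏ p ∈ t, p),
          (k : ℝ) ^ d.primeFactors.card := by rw [sum_image hinj]
    _ ≤ ∑ d ∈ m.divisors, (k : ℝ) ^ d.primeFactors.card :=
        sum_le_sum_of_subset_of_nonneg hsub fun d _ _ => by positivity

/-- **`∑_{q ≤ Q} k^{ω(q)}/q ≤ H_Q^k`** for `k ≥ 1`, where `H_Q = ∑_{m ≤ Q} 1/m` (induction on `k`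
via `succ_pow_card_primeFactors_le_sum_divisors` and `sum_sum_divisors_div_le`). [folklore] -/
theorem sum_pow_card_primeFactors_div_le {k : ℕ} (hk : 1 ≤ k) (Q : ℕ) :
    ∑ q ∈ Icc 1 Q, (k : ℝ) ^ q.primeFactors.card / q ≤ (∑ m ∈ Icc 1 Q, (1 : ℝ) / m) ^ k := by
  induction k, hk using Nat.le_induction with
  | base => simp
  | succ k hk ih =>
    have hH : 0 ≤ ∑ m ∈ Icc 1 Q, (1 : ℝ) / m := sum_nonneg fun m _ => by positivity
    calc ∑ q ∈ Icc 1 Q, ((k + 1 : ℕ) : ℝ) ^ q.primeFactors.card / q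
        ≤ ∑ q ∈ Icc 1 Q, (∑ d ∈ q.divisors, (k : ℝ) ^ d.primeFactors.card) / q := by
          refine sum_le_sum fun q hq => div_le_div_of_nonneg_right ?_ (Nat.cast_nonneg _)
          rw [Nat.cast_succ]
          exact succ_pow_card_primeFactors_le_sum_divisors k (by
            have := (mem_Icc.mp hq).1; omega)
      _ ≤ (∑ d ∈ Icc 1 Q, (k : ℝ) ^ d.primeFactors.card / d) * ∑ m ∈ Icc 1 Q, (1 : ℝ) / m :=
          sum_sum_divisors_div_le _ (fun d => by positivity) Q
      _ ≤ (∑ m ∈ Icc 1 Q, (1 : ℝ) / m) ^ k * ∑ m ∈ Icc 1 Q, (1 : ℝ) / m :=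
          mul_le_mul_of_nonneg_right ih hH
      _ = (∑ m ∈ Icc 1 Q, (1 : ℝ) / m) ^ (k + 1) := (pow_succ _ _).symm

/-- The harmonic bound `∑_{m ≤ Q} 1/m ≤ 1 + log Q` (Mathlib `harmonic_le_one_add_log`). [folklore] -/
theorem sum_Icc_one_div_le_one_add_log (Q : ℕ) :
    ∑ m ∈ Icc 1 Q, (1 : ℝ) / m ≤ 1 + Real.log Q := by
  have := harmonic_le_one_add_log Q
  rw [harmonic_eq_sum_Icc] at this
  push_cast at this
  simpa [one_div] using this

/-- The `2`-part: `ω(q) ≤ ω(q / 2^{v₂(q)}) + 1`. [folklore] -/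
theorem card_primeFactors_le_card_primeFactors_ordCompl_two_succ (q : ℕ) :
    q.primeFactors.card ≤ (q / 2 ^ q.factorization 2).primeFactors.card + 1 := by
  rcases eq_or_ne q 0 with rfl | hq
  · simp
  have hsub : q.primeFactors ⊆ insert 2 (q / 2 ^ q.factorization 2).primeFactors := by
    intro p hp
    have hpp : p.Prime := Nat.prime_of_mem_primeFactors hp
    have hpq : p ∣ q := Nat.dvd_of_mem_primeFactors hp
    rw [← Nat.ordProj_mul_ordCompl_eq_self q 2] at hpq
    rcases (Nat.Prime.dvd_mul hpp).mp hpq with h | h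
    · exact mem_insert.mpr (Or.inl ((Nat.prime_dvd_prime_iff_eq hpp Nat.prime_two).mp
        (hpp.dvd_of_dvd_pow h)))
    · exact mem_insert.mpr (Or.inr (Nat.mem_primeFactors.mpr
        ⟨hpp, h, (Nat.ordCompl_pos 2 hq).ne'⟩))
  exact (card_le_card hsub).trans (card_insert_le _ _)

/-- **`∑_{q ≤ Q} k^{ω(q)} 2^{v₂(q)}/q ≤ k (log₂ Q + 1) H_Q^k`** for `k ≥ 1`: split `q = 2^e m` with
`m` odd; for each of the `≤ log₂ Q + 1` values of `e` the inner sum is `≤ ∑_{m ≤ Q} k^{ω(m)+1}/m`.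
[folklore] -/
theorem sum_pow_card_primeFactors_mul_two_pow_div_le {k : ℕ} (hk : 1 ≤ k) (Q : ℕ) :
    ∑ q ∈ Icc 1 Q, (k : ℝ) ^ q.primeFactors.card * 2 ^ q.factorization 2 / q ≤
      k * (Nat.log 2 Q + 1) * (∑ m ∈ Icc 1 Q, (1 : ℝ) / m) ^ k := by
  set S : ℝ := ∑ m ∈ Icc 1 Q, (k : ℝ) ^ m.primeFactors.card / m with hS
  have hk1 : (1 : ℝ) ≤ k := by exact_mod_cast hk
  have hS0 : 0 ≤ S := sum_nonneg fun m _ => by positivity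
  -- fibre over `e = v₂(q)`
  have hmaps : ∀ q ∈ Icc 1 Q, q.factorization 2 ∈ range (Nat.log 2 Q + 1) := by
    intro q hq
    have hq1 : 1 ≤ q := (mem_Icc.mp hq).1
    rw [mem_range, Nat.lt_succ_iff]
    refine Nat.le_log_of_pow_le one_lt_two ((Nat.ordProj_le 2 (by omega)).trans (mem_Icc.mp hq).2)
  rw [← sum_fiberwise_of_maps_to hmaps]
  -- each fibre
  have hfib : ∀ e ∈ range (Nat.log 2 Q + 1),
      ∑ q ∈ (Icc 1 Q).filter (fun q => q.factorization 2 = e),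
        (k : ℝ) ^ q.primeFactors.card * 2 ^ q.factorization 2 / q ≤ k * S := by
    intro e _
    have hinj : Set.InjOn (fun q : ℕ => q / 2 ^ q.factorization 2)
        ((Icc 1 Q).filter (fun q => q.factorization 2 = e) : Set ℕ) := by
      intro q hq q' hq' h
      have h1 := Nat.ordProj_mul_ordCompl_eq_self q 2
      have h2 := Nat.ordProj_mul_ordCompl_eq_self q' 2
      simp only [coe_filter, Set.mem_setOf_eq] at hq hq'
      have h3 : q / 2 ^ q.factorization 2 = q' / 2 ^ q'.factorization 2 := h
      rw [← h1, ← h2, h3, hq.2, hq'.2]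
    calc ∑ q ∈ (Icc 1 Q).filter (fun q => q.factorization 2 = e),
          (k : ℝ) ^ q.primeFactors.card * 2 ^ q.factorization 2 / q
        ≤ ∑ q ∈ (Icc 1 Q).filter (fun q => q.factorization 2 = e),
            (k : ℝ) * ((k : ℝ) ^ (q / 2 ^ q.factorization 2).primeFactors.card /
              (q / 2 ^ q.factorization 2 : ℕ)) := by
          refine sum_le_sum fun q hq => ?_
          have hq1 : 1 ≤ q := (mem_Icc.mp (mem_filter.mp hq).1).1
          set v : ℕ := q.factorization 2 with hv
          set m : ℕ := q / 2 ^ v with hm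
          have hm0 : 0 < m := Nat.ordCompl_pos 2 (by omega)
          have hq0 : (0 : ℝ) < q := by exact_mod_cast hq1
          have hdiv : (m : ℝ) = q / 2 ^ v := by
            rw [hm, Nat.cast_div (Nat.ordProj_dvd q 2) (by positivity)]
            push_cast
            ring
          have hpow : (k : ℝ) ^ q.primeFactors.card ≤ k * (k : ℝ) ^ m.primeFactors.card := by
            rw [← pow_succ']
            exact pow_le_pow_right₀ hk1 (card_primeFactors_le_card_primeFactors_ordCompl_two_succ q)
          have hrhs : (k : ℝ) * ((k : ℝ) ^ m.primeFactors.card / m) =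
              (k * (k : ℝ) ^ m.primeFactors.card) * (2 ^ v / q) := by
            rw [hdiv]
            field_simp
          rw [hrhs, mul_div_assoc]
          exact mul_le_mul_of_nonneg_right hpow (by positivity)
      _ = k * ∑ m ∈ ((Icc 1 Q).filter (fun q => q.factorization 2 = e)).image
            (fun q : ℕ => q / 2 ^ q.factorization 2), (k : ℝ) ^ m.primeFactors.card / m := by
          rw [mul_sum, sum_image hinj]
      _ ≤ k * S := by
          refine mul_le_mul_of_nonneg_left (sum_le_sum_of_subset_of_nonneg ?_ fun m _ _ => by
            positivity) (by positivity)
          intro m hm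
          obtain ⟨q, hq, rfl⟩ := mem_image.mp hm
          have hq' := mem_Icc.mp (mem_filter.mp hq).1
          exact mem_Icc.mpr ⟨Nat.ordCompl_pos 2 (by omega), (Nat.ordCompl_le q 2).trans hq'.2⟩
  calc ∑ e ∈ range (Nat.log 2 Q + 1), ∑ q ∈ (Icc 1 Q).filter (fun q => q.factorization 2 = e),
        (k : ℝ) ^ q.primeFactors.card * 2 ^ q.factorization 2 / q
      ≤ ∑ e ∈ range (Nat.log 2 Q + 1), (k : ℝ) * S := sum_le_sum hfib
    _ = k * (Nat.log 2 Q + 1) * S := by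
        rw [sum_const, card_range, nsmul_eq_mul]; push_cast; ring
    _ ≤ k * (Nat.log 2 Q + 1) * (∑ m ∈ Icc 1 Q, (1 : ℝ) / m) ^ k :=
        mul_le_mul_of_nonneg_left (sum_pow_card_primeFactors_div_le hk Q) (by positivity)

/-- The un-normalised sum: `∑_{q ≤ Q} k^{ω(q)} 2^{v₂(q)} ≤ Q k (log₂ Q + 1) H_Q^k`. [folklore] -/
theorem sum_pow_card_primeFactors_mul_two_pow_le {k : ℕ} (hk : 1 ≤ k) (Q : ℕ) :
    ∑ q ∈ Icc 1 Q, (k : ℝ) ^ q.primeFactors.card * 2 ^ q.factorization 2 ≤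
      Q * (k * (Nat.log 2 Q + 1) * (∑ m ∈ Icc 1 Q, (1 : ℝ) / m) ^ k) := by
  refine le_trans ?_ (mul_le_mul_of_nonneg_left (sum_pow_card_primeFactors_mul_two_pow_div_le hk Q)
    (Nat.cast_nonneg Q))
  rw [mul_sum]
  refine sum_le_sum fun q hq => ?_
  have hq' := mem_Icc.mp hq
  have hq0 : (0 : ℝ) < q := by exact_mod_cast hq'.1
  have hqQ : (q : ℝ) ≤ Q := by exact_mod_cast hq'.2
  have hQq : (1 : ℝ) ≤ Q / q := (one_le_div hq0).mpr hqQ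
  calc (k : ℝ) ^ q.primeFactors.card * 2 ^ q.factorization 2
      = 1 * ((k : ℝ) ^ q.primeFactors.card * 2 ^ q.factorization 2) := (one_mul _).symm
    _ ≤ (Q / q) * ((k : ℝ) ^ q.primeFactors.card * 2 ^ q.factorization 2) :=
        mul_le_mul_of_nonneg_right hQq (by positivity)
    _ = Q * ((k : ℝ) ^ q.primeFactors.card * 2 ^ q.factorization 2 / q) := by ring

/-! ### Prime powers `p^k`, `k ≥ 2`, in a reduced residue class -/

/-- The integers `0 ≤ m ≤ N` with `m^k ≤ N` (`k ≥ 1`) number at most `N^{1/k} + 1`. [folklore] -/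
theorem card_range_filter_pow_le_le (N : ℕ) {k : ℕ} (hk : 0 < k) :
    (#((range (N + 1)).filter fun m : ℕ => m ^ k ≤ N) : ℝ) ≤ (N : ℝ) ^ (1 / (k : ℝ)) + 1 := by
  have hsub : ((range (N + 1)).filter fun m : ℕ => m ^ k ≤ N) ⊆
      range (⌊(N : ℝ) ^ (1 / (k : ℝ))⌋₊ + 1) := by
    intro m hm
    rw [mem_filter] at hm
    rw [mem_range, Nat.lt_succ_iff]
    refine Nat.le_floor ?_
    rw [one_div, Real.le_rpow_inv_iff_of_pos (Nat.cast_nonneg _) (Nat.cast_nonneg _)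
      (by exact_mod_cast hk), Real.rpow_natCast]
    exact_mod_cast hm.2
  calc (#((range (N + 1)).filter fun m : ℕ => m ^ k ≤ N) : ℝ)
      ≤ #(range (⌊(N : ℝ) ^ (1 / (k : ℝ))⌋₊ + 1)) := by exact_mod_cast card_le_card hsub
    _ = ⌊(N : ℝ) ^ (1 / (k : ℝ))⌋₊ + 1 := by rw [card_range]; push_cast; ring
    _ ≤ (N : ℝ) ^ (1 / (k : ℝ)) + 1 := by
        gcongr
        exact Nat.floor_le (by positivity)

/-- **Prime powers `p^k ≤ N`, `k ≥ 2`, in a reduced residue class `a (mod q)`.**  For every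
`k₁ ≥ 2`: `#{n ≤ N : n = p^k, k ≥ 2, n ≡ a (mod q)} ≤ k₁ · k₁^{ω(q)} 2^{v₂(q)} · (√N/q + 1)
+ log₂ N · (N^{1/(k₁+1)} + 1)`: the exponents `2 ≤ k ≤ k₁` are handled by
`card_range_filter_pow_eq_le` (with `p ≤ √N`), the exponents `k > k₁` trivially (`p ≤ N^{1/k}`).
[folklore] -/
theorem card_nonPrime_primePow_residue_le {q : ℕ} (hq : 0 < q) (a : (ZMod q)ˣ) (N : ℕ) {k₁ : ℕ}
    (hk₁ : 2 ≤ k₁) :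
    (#((range (N + 1)).filter fun n : ℕ => IsPrimePow n ∧ ¬n.Prime ∧ (n : ZMod q) = a) : ℝ) ≤
      k₁ * ((k₁ : ℝ) ^ q.primeFactors.card * 2 ^ q.factorization 2) * (Real.sqrt N / q + 1) +
        Nat.log 2 N * ((N : ℝ) ^ (1 / ((k₁ : ℝ) + 1)) + 1) := by
  classical
  set B : ℝ := (k₁ : ℝ) ^ q.primeFactors.card * 2 ^ q.factorization 2 with hB
  set K : ℕ := Nat.log 2 N with hK
  set A : ℕ → Finset ℕ := fun k =>
    (range (N + 1)).filter fun m : ℕ => m ^ k ≤ N ∧ ((m ^ k : ℕ) : ZMod q) = a with hA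
  -- every non-prime prime power `n ≤ N` in the class is `m^k` with `m ∈ A k`, `2 ≤ k ≤ K`
  have hcover : ((range (N + 1)).filter fun n : ℕ => IsPrimePow n ∧ ¬n.Prime ∧ (n : ZMod q) = a) ⊆
      (Icc 2 K).biUnion fun k => (A k).image fun m => m ^ k := by
    intro n hn
    rw [mem_filter, mem_range] at hn
    obtain ⟨hnN, hpp, hnp, hna⟩ := hn
    obtain ⟨k, hkn, hk0, p, hpn, rfl, hp⟩ := (isPrimePow_nat_iff_bounded_log _).mp hpp
    have hk2 : 2 ≤ k := by
      by_contra h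
      have hk1 : k = 1 := by omega
      rw [hk1, pow_one] at hnp
      exact hnp hp
    have hkK : k ≤ K := hkn.trans (Nat.log_mono_right (Nat.le_of_lt_succ hnN))
    refine mem_biUnion.mpr ⟨k, mem_Icc.mpr ⟨hk2, hkK⟩, mem_image.mpr ⟨p, ?_, rfl⟩⟩
    rw [hA, mem_filter, mem_range]
    exact ⟨Nat.lt_succ_of_le (hpn.trans (Nat.le_of_lt_succ hnN)), Nat.le_of_lt_succ hnN, hna⟩
  have hcard : (#((range (N + 1)).filter
      fun n : ℕ => IsPrimePow n ∧ ¬n.Prime ∧ (n : ZMod q) = a) : ℝ) ≤ ∑ k ∈ Icc 2 K, (#(A k) : ℝ) := by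
    have := (card_le_card hcover).trans (card_biUnion_le.trans
      (sum_le_sum fun k _ => card_image_le (f := fun m => m ^ k) (s := A k)))
    exact_mod_cast this
  -- exponents `k ≤ k₁`
  have hsmall : ∀ k ∈ Icc 2 K, k ≤ k₁ → (#(A k) : ℝ) ≤ B * (Real.sqrt N / q + 1) := by
    intro k hk hkk₁
    have hk2 : 2 ≤ k := (mem_Icc.mp hk).1
    have hsub : A k ⊆ (range (Nat.sqrt N + 1)).filter fun m : ℕ => (m : ZMod q) ^ k = a := by
      intro m hm
      rw [hA, mem_filter, mem_range] at hm
      rw [mem_filter, mem_range, Nat.lt_succ_iff, Nat.le_sqrt']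
      refine ⟨?_, by rw [← Nat.cast_pow]; exact hm.2.2⟩
      rcases Nat.eq_zero_or_pos m with rfl | hm0
      · simp
      · exact (Nat.pow_le_pow_right hm0 hk2).trans hm.2.1
    have h1 := card_le_card hsub
    have h2 := card_range_filter_pow_eq_le (by omega : 0 < k) hq a (Nat.sqrt N)
    have h3 : (k : ℝ) ^ q.primeFactors.card * 2 ^ q.factorization 2 ≤ B := by
      rw [hB]
      gcongr
    have h4 : ((Nat.sqrt N / q : ℕ) : ℝ) ≤ Real.sqrt N / q :=
      Nat.cast_div_le.trans (div_le_div_of_nonneg_right Real.nat_sqrt_le_real_sqrt (Nat.cast_nonneg _))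
    calc (#(A k) : ℝ)
        ≤ ((k ^ q.primeFactors.card * 2 ^ q.factorization 2 * (Nat.sqrt N / q + 1) : ℕ) : ℝ) := by
          exact_mod_cast h1.trans h2
      _ ≤ (k : ℝ) ^ q.primeFactors.card * 2 ^ q.factorization 2 * (Real.sqrt N / q + 1) := by
          push_cast
          gcongr
      _ ≤ B * (Real.sqrt N / q + 1) := mul_le_mul_of_nonneg_right h3 (by positivity)
  -- exponents `k > k₁`
  have hlarge : ∀ k ∈ Icc 2 K, ¬k ≤ k₁ → (#(A k) : ℝ) ≤ (N : ℝ) ^ (1 / ((k₁ : ℝ) + 1)) + 1 := by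
    intro k hk hkk₁
    have hk0 : 0 < k := by have := (mem_Icc.mp hk).1; omega
    have hsub : A k ⊆ (range (N + 1)).filter fun m : ℕ => m ^ k ≤ N := by
      intro m hm
      rw [hA, mem_filter] at hm
      exact mem_filter.mpr ⟨hm.1, hm.2.1⟩
    calc (#(A k) : ℝ) ≤ #((range (N + 1)).filter fun m : ℕ => m ^ k ≤ N) := by
          exact_mod_cast card_le_card hsub
      _ ≤ (N : ℝ) ^ (1 / (k : ℝ)) + 1 := card_range_filter_pow_le_le N hk0
      _ ≤ (N : ℝ) ^ (1 / ((k₁ : ℝ) + 1)) + 1 := by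
          gcongr ?_ + 1
          rcases Nat.eq_zero_or_pos N with rfl | hN
          · rw [Nat.cast_zero, Real.zero_rpow (one_div_pos.mpr (by positivity)).ne',
              Real.zero_rpow (one_div_pos.mpr (by positivity)).ne']
          · refine Real.rpow_le_rpow_of_exponent_le (by exact_mod_cast hN) ?_
            rw [one_div_le_one_div (by positivity) (by positivity)]
            exact_mod_cast (by omega : k₁ + 1 ≤ k)
  -- combine
  rw [← sum_filter_add_sum_filter_not (Icc 2 K) (fun k => k ≤ k₁)] at hcard
  have hS1 : ∑ k ∈ (Icc 2 K).filter (fun k => k ≤ k₁), (#(A k) : ℝ) ≤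
      k₁ * (B * (Real.sqrt N / q + 1)) := by
    calc ∑ k ∈ (Icc 2 K).filter (fun k => k ≤ k₁), (#(A k) : ℝ)
        ≤ ∑ k ∈ (Icc 2 K).filter (fun k => k ≤ k₁), B * (Real.sqrt N / q + 1) :=
          sum_le_sum fun k hk => hsmall k (mem_filter.mp hk).1 (mem_filter.mp hk).2
      _ = #((Icc 2 K).filter (fun k => k ≤ k₁)) * (B * (Real.sqrt N / q + 1)) := by
          rw [sum_const, nsmul_eq_mul]
      _ ≤ k₁ * (B * (Real.sqrt N / q + 1)) := by
          have hc : #((Icc 2 K).filter (fun k => k ≤ k₁)) ≤ k₁ :=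
            (card_le_card (t := Icc 1 k₁) fun k hk => by
              simp only [mem_filter, mem_Icc] at hk ⊢; omega).trans (by simp)
          have hc' : (#((Icc 2 K).filter (fun k => k ≤ k₁)) : ℝ) ≤ k₁ := by exact_mod_cast hc
          gcongr
  have hS2 : ∑ k ∈ (Icc 2 K).filter (fun k => ¬k ≤ k₁), (#(A k) : ℝ) ≤
      K * ((N : ℝ) ^ (1 / ((k₁ : ℝ) + 1)) + 1) := by
    calc ∑ k ∈ (Icc 2 K).filter (fun k => ¬k ≤ k₁), (#(A k) : ℝ)
        ≤ ∑ k ∈ (Icc 2 K).filter (fun k => ¬k ≤ k₁), ((N : ℝ) ^ (1 / ((k₁ : ℝ) + 1)) + 1) :=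
          sum_le_sum fun k hk => hlarge k (mem_filter.mp hk).1 (mem_filter.mp hk).2
      _ = #((Icc 2 K).filter (fun k => ¬k ≤ k₁)) * ((N : ℝ) ^ (1 / ((k₁ : ℝ) + 1)) + 1) := by
          rw [sum_const, nsmul_eq_mul]
      _ ≤ K * ((N : ℝ) ^ (1 / ((k₁ : ℝ) + 1)) + 1) := by
          have hc : #((Icc 2 K).filter (fun k => ¬k ≤ k₁)) ≤ K :=
            (card_le_card (t := Icc 1 K) fun k hk => by
              simp only [mem_filter, mem_Icc] at hk ⊢; omega).trans (by simp)
          have hc' : (#((Icc 2 K).filter (fun k => ¬k ≤ k₁)) : ℝ) ≤ K := by exact_mod_cast hc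
          gcongr
  calc _ ≤ _ := hcard
    _ ≤ k₁ * (B * (Real.sqrt N / q + 1)) + K * ((N : ℝ) ^ (1 / ((k₁ : ℝ) + 1)) + 1) :=
        add_le_add hS1 hS2
    _ = _ := by rw [hB]; ring

/-- The prime-power part of `ψ(N; q, a)` is at most `log N` times the number of non-prime prime
powers `n ≤ N` in the class `a (mod q)` (`Λ(p^k) = log p ≤ log N`). [folklore] -/
theorem sum_nonPrime_vonMangoldt_residue_le_mul_card {q : ℕ} (a : ZMod q) (N : ℕ) :
    ∑ n ∈ range (N + 1), (if n.Prime then 0 else if (n : ZMod q) = a then Λ n else 0) ≤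
      Real.log N *
        #((range (N + 1)).filter fun n : ℕ => IsPrimePow n ∧ ¬n.Prime ∧ (n : ZMod q) = a) := by
  rw [mul_comm, ← nsmul_eq_mul, ← sum_const, sum_filter]
  refine sum_le_sum fun n hn => ?_
  have hnN : (n : ℝ) ≤ N := by exact_mod_cast Nat.le_of_lt_succ (mem_range.mp hn)
  have hlogN : 0 ≤ Real.log N := Real.log_natCast_nonneg N
  by_cases hp : n.Prime
  · simp [hp]
  by_cases ha : (n : ZMod q) = a
  · by_cases hpp : IsPrimePow n
    · rw [if_neg hp, if_pos ha, if_pos ⟨hpp, hp, ha⟩]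
      have hn0 : (0 : ℝ) < n := by exact_mod_cast hpp.pos
      exact ArithmeticFunction.vonMangoldt_le_log.trans (Real.log_le_log hn0 hnN)
    · rw [if_neg hp, if_pos ha, ArithmeticFunction.vonMangoldt_eq_zero_iff.mpr hpp]
      split_ifs <;> exact hlogN.trans_eq' rfl |>.trans_eq rfl |> fun h => by linarith
  · rw [if_neg hp, if_neg ha]
    split_ifs
    · exact hlogN
    · exact le_rfl

/-- **Prime powers in arithmetic progressions on average over the modulus** (pointwise in `N`,
`Q`).  For `k₁ ≥ 2`,
`∑_{q ≤ Q} max_{(a,q)=1} ∑_{n ≤ N, n non-prime, n ≡ a (q)} Λ(n)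
  ≤ log N · (k₁² (log₂ Q + 1)(1 + log Q)^{k₁} (√N + Q) + Q log₂ N (N^{1/(k₁+1)} + 1))`.
With `Q ≤ x^{1−ε}`, `N = ⌊x⌋` and `k₁ ≈ 2/ε` the right side is `≪ x^{1−ε/2+o(1)}`
(`LevelOfDistributionProofs.lean`). [folklore] -/
theorem sum_Icc_iSup_nonPrime_vonMangoldt_residue_le (N Q : ℕ) {k₁ : ℕ} (hk₁ : 2 ≤ k₁) :
    ∑ q ∈ Icc 1 Q, ⨆ a : (ZMod q)ˣ,
        ∑ n ∈ range (N + 1), (if n.Prime then 0 else if (n : ZMod q) = a then Λ n else 0) ≤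
      Real.log N * (k₁ * (k₁ * (Nat.log 2 Q + 1) * (1 + Real.log Q) ^ k₁) * (Real.sqrt N + Q) +
        Q * (Nat.log 2 N * ((N : ℝ) ^ (1 / ((k₁ : ℝ) + 1)) + 1))) := by
  have hlogN : 0 ≤ Real.log N := Real.log_natCast_nonneg N
  have hk₁1 : 1 ≤ k₁ := by omega
  set S : ℝ := k₁ * (Nat.log 2 Q + 1) * (∑ m ∈ Icc 1 Q, (1 : ℝ) / m) ^ k₁ with hS
  set S' : ℝ := k₁ * (Nat.log 2 Q + 1) * (1 + Real.log Q) ^ k₁ with hS'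
  have hSS' : S ≤ S' := by
    rw [hS, hS']
    exact mul_le_mul_of_nonneg_left (pow_le_pow_left₀ (sum_nonneg fun m _ => by positivity)
      (sum_Icc_one_div_le_one_add_log Q) k₁) (by positivity)
  set R : ℝ := Nat.log 2 N * ((N : ℝ) ^ (1 / ((k₁ : ℝ) + 1)) + 1) with hR
  have hR0 : 0 ≤ R := by positivity
  -- pointwise bound for each `q`
  have hpt : ∀ q ∈ Icc 1 Q, (⨆ a : (ZMod q)ˣ,
      ∑ n ∈ range (N + 1), (if n.Prime then 0 else if (n : ZMod q) = a then Λ n else 0)) ≤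
      Real.log N * (k₁ * ((k₁ : ℝ) ^ q.primeFactors.card * 2 ^ q.factorization 2) *
        (Real.sqrt N / q + 1) + R) := by
    intro q hq
    have hq1 : 0 < q := (mem_Icc.mp hq).1
    refine Real.iSup_le (fun a => ?_) (by positivity)
    exact (sum_nonPrime_vonMangoldt_residue_le_mul_card (a : ZMod q) N).trans
      (mul_le_mul_of_nonneg_left (card_nonPrime_primePow_residue_le hq1 a N hk₁) hlogN)
  refine (sum_le_sum hpt).trans ?_
  rw [← mul_sum, sum_add_distrib, sum_const, Nat.card_Icc, Nat.add_sub_cancel, nsmul_eq_mul]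
  refine mul_le_mul_of_nonneg_left ?_ hlogN
  -- `∑_q k₁ B(q) (√N/q + 1) = k₁ (√N ∑ B(q)/q + ∑ B(q)) ≤ k₁ (√N S + Q S)`
  have h1 : ∑ q ∈ Icc 1 Q, (k₁ : ℝ) * ((k₁ : ℝ) ^ q.primeFactors.card * 2 ^ q.factorization 2) *
      (Real.sqrt N / q + 1) =
      k₁ * (Real.sqrt N * ∑ q ∈ Icc 1 Q, (k₁ : ℝ) ^ q.primeFactors.card * 2 ^ q.factorization 2 / q +
        ∑ q ∈ Icc 1 Q, (k₁ : ℝ) ^ q.primeFactors.card * 2 ^ q.factorization 2) := by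
    simp only [mul_add, mul_sum, ← sum_add_distrib]
    refine sum_congr rfl fun q _ => ?_
    ring
  have h2 := sum_pow_card_primeFactors_mul_two_pow_div_le hk₁1 Q
  have h3 := sum_pow_card_primeFactors_mul_two_pow_le hk₁1 Q
  rw [h1]
  have h4 : Real.sqrt N * ∑ q ∈ Icc 1 Q, (k₁ : ℝ) ^ q.primeFactors.card * 2 ^ q.factorization 2 / q +
      ∑ q ∈ Icc 1 Q, (k₁ : ℝ) ^ q.primeFactors.card * 2 ^ q.factorization 2 ≤ S' * (Real.sqrt N + Q) := by
    have := Real.sqrt_nonneg (N : ℝ)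
    calc _ ≤ Real.sqrt N * S + Q * S := add_le_add (mul_le_mul_of_nonneg_left h2 this) h3
      _ = S * (Real.sqrt N + Q) := by ring
      _ ≤ S' * (Real.sqrt N + Q) := mul_le_mul_of_nonneg_right hSS' (by positivity)
  have hk₁0 : (0 : ℝ) ≤ k₁ := Nat.cast_nonneg _
  nlinarith [mul_le_mul_of_nonneg_left h4 hk₁0]

/-! ### The asymptotic form: `Q ≤ x^{1−ε}` -/

/-- A power saving absorbs powers of `log`: for `δ > 0`, `n : ℕ` and real `B`, eventually
`x^{1−δ} (1 + log x)^n ≤ x/(log x)^B`. [folklore] -/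
theorem eventually_rpow_mul_one_add_log_pow_le {δ : ℝ} (hδ : 0 < δ) (n : ℕ) (B : ℝ) :
    ∀ᶠ x : ℝ in atTop, x ^ (1 - δ) * (1 + Real.log x) ^ n ≤ x / Real.log x ^ B := by
  have hlo := (isLittleO_log_rpow_rpow_atTop ((n : ℝ) + max B 0) hδ).def
    (by positivity : (0 : ℝ) < 1 / 2 ^ n)
  filter_upwards [hlo, eventually_ge_atTop (Real.exp 1)] with x hx hxe
  have hx0 : 0 < x := (Real.exp_pos 1).trans_le hxe
  have hL : 1 ≤ Real.log x := by rwa [Real.le_log_iff_exp_le hx0]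
  have hL0 : 0 < Real.log x := by linarith
  rw [Real.norm_of_nonneg (Real.rpow_nonneg hL0.le _), Real.norm_of_nonneg (Real.rpow_nonneg hx0.le _),
    Real.rpow_add hL0, Real.rpow_natCast] at hx
  -- `hx : (log x)^n (log x)^{B'} ≤ x^δ / 2^n`
  have h1 : (1 + Real.log x) ^ n ≤ 2 ^ n * Real.log x ^ n := by
    rw [← mul_pow]
    exact pow_le_pow_left₀ (by positivity) (by linarith) n
  have h2 : Real.log x ^ B ≤ Real.log x ^ (max B 0) :=
    Real.rpow_le_rpow_of_exponent_le hL (le_max_left _ _)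
  have hB0 : 0 < Real.log x ^ B := Real.rpow_pos_of_pos hL0 B
  have hB1 : 0 < Real.log x ^ (max B 0) := Real.rpow_pos_of_pos hL0 _
  rw [le_div_iff₀ hB0]
  calc x ^ (1 - δ) * (1 + Real.log x) ^ n * Real.log x ^ B
      ≤ x ^ (1 - δ) * (2 ^ n * Real.log x ^ n) * Real.log x ^ (max B 0) := by gcongr
    _ = x ^ (1 - δ) * (2 ^ n * (Real.log x ^ n * Real.log x ^ (max B 0))) := by ring
    _ ≤ x ^ (1 - δ) * (2 ^ n * (1 / 2 ^ n * x ^ δ)) := by gcongr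
    _ = x := by
        rw [← mul_assoc (2 ^ n : ℝ), mul_one_div_cancel (by positivity), one_mul,
          ← Real.rpow_add hx0]
        norm_num

/-- `Nat.log 2 M ≤ 2 log x` for `M ≤ x`, `x ≥ 1`. [folklore] -/
theorem natLog_two_le_two_mul_log {M : ℕ} {x : ℝ} (hM : (M : ℝ) ≤ x) (hx : 1 ≤ x) :
    (Nat.log 2 M : ℝ) ≤ 2 * Real.log x := by
  have hlx : 0 ≤ Real.log x := Real.log_nonneg hx
  rcases Nat.eq_zero_or_pos M with rfl | hM0
  · simp [hlx]
  have h1 : ((2 ^ Nat.log 2 M : ℕ) : ℝ) ≤ M := by exact_mod_cast Nat.pow_log_le_self 2 hM0.ne'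
  have h2 : (Nat.log 2 M : ℝ) * Real.log 2 ≤ Real.log x := by
    rw [← Real.log_pow]
    push_cast at h1
    exact Real.log_le_log (by positivity) (h1.trans hM)
  nlinarith [Real.log_two_gt_d9]

/-- `log M ≤ log x` for a natural number `M ≤ x`, `x ≥ 1` (including `M = 0`). [folklore] -/
theorem log_natCast_le_log {M : ℕ} {x : ℝ} (hM : (M : ℝ) ≤ x) (hx : 1 ≤ x) :
    Real.log M ≤ Real.log x := by
  rcases Nat.eq_zero_or_pos M with rfl | hM0
  · simpa using Real.log_nonneg hx
  · exact Real.log_le_log (by exact_mod_cast hM0) hM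

/-- **Prime powers in arithmetic progressions, on average over the modulus** (asymptotic form).
For every `ε > 0` and real `A`, eventually in `x`: for all `Q ≤ x^{1−ε}`,
`∑_{q ≤ Q} max_{(a,q)=1} ∑_{n ≤ x, n non-prime, n ≡ a (q)} Λ(n) ≤ x/(log x)^A`.
(From `sum_Icc_iSup_nonPrime_vonMangoldt_residue_le` with `k₁ = ⌈2/ε⌉ + 2`, whose bound is
`≪_ε x^{1−min(1/2, ε/2)} (1 + log x)^{k₁+2}`.)  This is the input that makes the `ψ`- and
`π`-forms of "level of distribution `x^θ`" equivalent for `θ ≤ 1`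
(`Literature.NumberTheory.Sieve.primesHaveLevel_iff_primesHaveLevelPi`). [folklore] -/
theorem eventually_sum_iSup_nonPrime_vonMangoldt_residue_le {ε : ℝ} (hε : 0 < ε) (A : ℝ) :
    ∀ᶠ x : ℝ in atTop, ∀ Q : ℕ, (Q : ℝ) ≤ x ^ (1 - ε) →
      ∑ q ∈ Icc 1 Q, ⨆ a : (ZMod q)ˣ,
          ∑ n ∈ range (⌊x⌋₊ + 1), (if n.Prime then 0 else if (n : ZMod q) = a then Λ n else 0) ≤
        x / Real.log x ^ A := by
  set k₁ : ℕ := ⌈2 / ε⌉₊ + 2 with hk₁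
  have hk₁2 : 2 ≤ k₁ := by omega
  have hk₁ε : 1 / ((k₁ : ℝ) + 1) ≤ ε / 2 := by
    rw [div_le_iff₀ (by positivity)]
    have hc : 2 / ε ≤ ⌈2 / ε⌉₊ := Nat.le_ceil _
    have hk : (k₁ : ℝ) = ⌈2 / ε⌉₊ + 2 := by rw [hk₁]; push_cast; ring
    rw [hk]
    have : 2 / ε * ε = 2 := div_mul_cancel₀ _ hε.ne'
    nlinarith
  set δ : ℝ := min (1 / 2) (ε / 2) with hδ
  have hδ0 : 0 < δ := lt_min one_half_pos (half_pos hε)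
  have hδhalf : δ ≤ 1 / 2 := min_le_left _ _
  have hδε : δ ≤ ε / 2 := min_le_right _ _
  filter_upwards [eventually_rpow_mul_one_add_log_pow_le hδ0 (k₁ + 2) (A + 1),
    eventually_ge_atTop (3 : ℝ),
    (Real.tendsto_log_atTop.eventually_ge_atTop (8 * (k₁ : ℝ) ^ 2))] with x hpoly hx3 hlogk Q hQ
  -- notation and basic facts
  have hx1 : (1 : ℝ) ≤ x := by linarith
  have hx0 : (0 : ℝ) < x := by linarith
  set N : ℕ := ⌊x⌋₊ with hN
  set L : ℝ := 1 + Real.log x with hL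
  have hlx : 0 ≤ Real.log x := Real.log_nonneg hx1
  have hL1 : 1 ≤ L := by rw [hL]; linarith
  have hL0' : 0 ≤ L := by linarith
  have hNx : (N : ℝ) ≤ x := Nat.floor_le hx0.le
  have hQx : (Q : ℝ) ≤ x := hQ.trans (by
    simpa using Real.rpow_le_rpow_of_exponent_le hx1 (by linarith : 1 - ε ≤ 1))
  set P : ℝ := x ^ (1 - δ) with hP
  have hP0 : 0 ≤ P := Real.rpow_nonneg hx0.le _
  have hlQ : 0 ≤ Real.log Q := Real.log_natCast_nonneg Q
  have hlN : 0 ≤ Real.log N := Real.log_natCast_nonneg N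
  -- the factors
  have f1 : Real.log N ≤ L := (log_natCast_le_log hNx hx1).trans (by rw [hL]; linarith)
  have f2 : (Nat.log 2 Q : ℝ) + 1 ≤ 2 * L := by
    have := natLog_two_le_two_mul_log hQx hx1
    rw [hL]; linarith
  have f3 : (1 + Real.log Q) ^ k₁ ≤ L ^ k₁ :=
    pow_le_pow_left₀ (by linarith) (by rw [hL]; linarith [log_natCast_le_log hQx hx1]) k₁
  have f4 : (Nat.log 2 N : ℝ) ≤ 2 * L := by
    have := natLog_two_le_two_mul_log hNx hx1
    rw [hL]; linarith
  have f5 : Real.sqrt N ≤ P := by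
    calc Real.sqrt N ≤ Real.sqrt x := Real.sqrt_le_sqrt hNx
      _ = x ^ (1 / 2 : ℝ) := Real.sqrt_eq_rpow x
      _ ≤ P := Real.rpow_le_rpow_of_exponent_le hx1 (by linarith)
  have f6' : x ^ (1 - ε) ≤ P := Real.rpow_le_rpow_of_exponent_le hx1 (by linarith)
  have f6 : (Q : ℝ) ≤ P := hQ.trans f6'
  have f7 : (Q : ℝ) * ((N : ℝ) ^ (1 / ((k₁ : ℝ) + 1)) + 1) ≤ 2 * P := by
    have h1 : (N : ℝ) ^ (1 / ((k₁ : ℝ) + 1)) ≤ x ^ (ε / 2) :=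
      (Real.rpow_le_rpow (Nat.cast_nonneg N) hNx (by positivity)).trans
        (Real.rpow_le_rpow_of_exponent_le hx1 hk₁ε)
    have h2 : x ^ (1 - ε) * x ^ (ε / 2) ≤ P := by
      rw [← Real.rpow_add hx0]
      exact Real.rpow_le_rpow_of_exponent_le hx1 (by linarith)
    calc (Q : ℝ) * ((N : ℝ) ^ (1 / ((k₁ : ℝ) + 1)) + 1)
        ≤ x ^ (1 - ε) * (x ^ (ε / 2) + 1) :=
          mul_le_mul hQ (by linarith) (by positivity) (Real.rpow_nonneg hx0.le _)
      _ = x ^ (1 - ε) * x ^ (ε / 2) + x ^ (1 - ε) := by ring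
      _ ≤ P + P := add_le_add h2 f6'
      _ = 2 * P := by ring
  -- assemble the pointwise bound
  have hmain := sum_Icc_iSup_nonPrime_vonMangoldt_residue_le N Q hk₁2
  have hk₁0 : (0 : ℝ) ≤ k₁ := Nat.cast_nonneg _
  have hk1sq : (1 : ℝ) ≤ (k₁ : ℝ) ^ 2 := one_le_pow₀ (by exact_mod_cast (by omega : 1 ≤ k₁))
  have g1 : (k₁ : ℝ) * (k₁ * (Nat.log 2 Q + 1) * (1 + Real.log Q) ^ k₁) * (Real.sqrt N + Q) ≤
      k₁ * (k₁ * (2 * L) * L ^ k₁) * (P + P) := by gcongr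
  have g2 : (Q : ℝ) * (Nat.log 2 N * ((N : ℝ) ^ (1 / ((k₁ : ℝ) + 1)) + 1)) ≤ 2 * L * (2 * P) := by
    calc (Q : ℝ) * (Nat.log 2 N * ((N : ℝ) ^ (1 / ((k₁ : ℝ) + 1)) + 1))
        = Nat.log 2 N * (Q * ((N : ℝ) ^ (1 / ((k₁ : ℝ) + 1)) + 1)) := by ring
      _ ≤ 2 * L * (2 * P) := mul_le_mul f4 f7 (by positivity) (by positivity)
  have g4 : L ^ 2 ≤ (k₁ : ℝ) ^ 2 * L ^ (k₁ + 2) := by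
    calc L ^ 2 = 1 * L ^ 2 := (one_mul _).symm
      _ ≤ (k₁ : ℝ) ^ 2 * L ^ (k₁ + 2) :=
          mul_le_mul hk1sq (pow_le_pow_right₀ hL1 (by omega)) (by positivity) (by positivity)
  have hbound : Real.log N * (k₁ * (k₁ * (Nat.log 2 Q + 1) * (1 + Real.log Q) ^ k₁) *
      (Real.sqrt N + Q) + Q * (Nat.log 2 N * ((N : ℝ) ^ (1 / ((k₁ : ℝ) + 1)) + 1))) ≤
      8 * (k₁ : ℝ) ^ 2 * (P * L ^ (k₁ + 2)) := by
    calc Real.log N * (k₁ * (k₁ * (Nat.log 2 Q + 1) * (1 + Real.log Q) ^ k₁) *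
          (Real.sqrt N + Q) + Q * (Nat.log 2 N * ((N : ℝ) ^ (1 / ((k₁ : ℝ) + 1)) + 1)))
        ≤ Real.log N * (k₁ * (k₁ * (2 * L) * L ^ k₁) * (P + P) + 2 * L * (2 * P)) :=
          mul_le_mul_of_nonneg_left (add_le_add g1 g2) hlN
      _ ≤ L * (k₁ * (k₁ * (2 * L) * L ^ k₁) * (P + P) + 2 * L * (2 * P)) :=
          mul_le_mul_of_nonneg_right f1 (by positivity)
      _ = 4 * (k₁ : ℝ) ^ 2 * (P * L ^ (k₁ + 2)) + 4 * P * L ^ 2 := by ring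
      _ ≤ 4 * (k₁ : ℝ) ^ 2 * (P * L ^ (k₁ + 2)) + 4 * P * ((k₁ : ℝ) ^ 2 * L ^ (k₁ + 2)) := by
          gcongr
      _ = 8 * (k₁ : ℝ) ^ 2 * (P * L ^ (k₁ + 2)) := by ring
  -- final: `8 k₁² · P L^{k₁+2} ≤ 8 k₁² · x/(log x)^{A+1} ≤ x/(log x)^A`
  have hL0 : 0 < Real.log x := by
    have h8 : (8 : ℝ) ≤ 8 * (k₁ : ℝ) ^ 2 := by nlinarith
    linarith
  have hfin : 8 * (k₁ : ℝ) ^ 2 * (x / Real.log x ^ (A + 1)) ≤ x / Real.log x ^ A := by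
    have hY : 0 ≤ x / Real.log x ^ A := div_nonneg hx0.le (Real.rpow_nonneg hL0.le A)
    rw [Real.rpow_add_one hL0.ne', ← div_div,
      show 8 * (k₁ : ℝ) ^ 2 * (x / Real.log x ^ A / Real.log x) =
        (8 * (k₁ : ℝ) ^ 2 / Real.log x) * (x / Real.log x ^ A) by ring]
    exact mul_le_of_le_one_left hY ((div_le_one hL0).mpr hlogk)
  calc _ ≤ _ := hmain
    _ ≤ 8 * (k₁ : ℝ) ^ 2 * (P * L ^ (k₁ + 2)) := hbound
    _ ≤ 8 * (k₁ : ℝ) ^ 2 * (x / Real.log x ^ (A + 1)) :=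
        mul_le_mul_of_nonneg_left hpoly (by positivity)
    _ ≤ x / Real.log x ^ A := hfin

end Literature.NumberTheory.Sieve
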